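import Summits.NavierStokesRegularity.NavierStokesRegularity.Theorems.ExtremiserTransienceZoneTransversalityDefs
import Summits.NavierStokesRegularity.NavierStokesRegularity.Theorems.ExtremiserTransienceKStarAttainedHalfSpaceVariation
import HarnessLib

/-!
# Route `ExtremiserTransience`, crux `NearExtremalTransiencePerFlow` (stmt-NavierStokesRegularity-26567),
# LINE g12-β `depleted_fraction` (ns-idea-5 g12): THE TWO STATEMENTS OF THE LINE (texts of record)

Texts of record, VERBATIM §1 of the files-only skeleton
`Summits/NavierStokesRegularity/NavierStokesRegularity/Cruxes/NearExtremalTransiencePerFlow/Lines/depleted_fraction.lean`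
(planner ns-idea-5 g12, crux-write 2f495cb0319b, lines :76 / :94), so that the by-text stub W♭
`stub_cleanLockedWindow : CleanLockedWindow` can be cited BY NAME on the Theorems side (a Theorems file may not import a `Cruxes/`
skeleton) and the heart X♭ `DepletedFraction` has a Theorems-side name:

* `DepletedFraction` — X♭, the HEART (OPEN): after a Taylor-locked slice with gradient and height control on a turnover window,
  the `ε`-depleted times occupy measure `≥ ε·|I|` of the window;
* `CleanLockedWindow` — W♭ (flow side): a violator has one locked packaged instant with an `η`-clean forward window (proved:
  `DepletedFraction.cleanLockedWindow_holds`, whose type is this body verbatim).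

The two definitions are definitionally equal to the skeleton's (same bodies, same opens), so a theorem `… : CleanLockedWindow` proved
against this file closes the skeleton's `sorry` by `exact`.  HONEST FRAMING: definitions only; X♭, the crux ⟨26567⟩ and NS regularity
are OPEN; nothing about Navier–Stokes regularity or blow-up is proved; no summit is proved by a line.
-/

noncomputable section

open scoped Topology InnerProductSpace RealInnerProductSpace ENNReal ContDiff
open MeasureTheory Filter Set Metric
open Literature.Analysis.FluidPDE
open Summit.NavierStokesRegularity.NavierStokesRegularity.Theorems
open Summit.NavierStokesRegularity.NavierStokesRegularity.Theorems.DepletionLadder.KStar.HalfSpace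
open Summit.NavierStokesRegularity.NavierStokesRegularity.Theorems.NearExtremalTransiencePerFlow.ZoneTransversality

namespace Summit.NavierStokesRegularity.NavierStokesRegularity.Theorems.NearExtremalTransiencePerFlow.DepletedFraction

-- the summit's namespace repeats the problem name by convention (D-0017)
set_option linter.dupNamespace false
set_option linter.style.longLine false

/-- **X♭ — DEPLETED FRACTION (HEART, OPEN).**  For classical Leray–Hopf flows from rapidly decaying data on `[0,T) × ℝ³`: after a
Taylor-locked slice with height bound `M`, gradient `≤ G M²/ν` and heights `≤ H M` on `I = [t, t + τ₁ν/M²]`, the `ε`-depleted times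
(flow-wise clause with coefficient `κ⋆ − ε` at every height bound) occupy measure `≥ ε|I|` of `I`.  `∀ Θ G H τ₁ > 0 ∃ ε > 0`. -/
def DepletedFraction : Prop :=
  ∀ (Θ G H τ₁ : ℝ), 0 < Θ → 0 < G → 0 < H → 0 < τ₁ → ∃ ε : ℝ, 0 < ε ∧
    ∀ (ν T : ℝ), 0 < ν → 0 < T →
    ∀ (u : ℝ → EuclideanSpace ℝ (Fin 3) → EuclideanSpace ℝ (Fin 3)) (p : ℝ → EuclideanSpace ℝ (Fin 3) → ℝ),
      IsClassicalNSSolutionOn (Set.Ico 0 T) ν 0 u p → IsLerayHopfOn T ν 0 (u 0) u → HasRapidSpatialDecay (u 0) →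
    ∀ (t M : ℝ), 0 ≤ t → 0 < M → t + τ₁ * ν / M ^ 2 < T →
      (∀ x, ‖u t x‖ ≤ M) →
      (∫ x, ‖curl (u t) x‖ ^ 2) ≤ Θ * (ν / M) ^ 2 * (∫ x, frobeniusNormSq (fderiv ℝ (curl (u t)) x)) →
      (∀ x, ‖fderiv ℝ (u t) x‖ ≤ G * M ^ 2 / ν) →
      (∀ t' ∈ Set.Icc t (t + τ₁ * ν / M ^ 2), ∀ x, ‖u t' x‖ ≤ H * M) →
      ENNReal.ofReal (ε * (τ₁ * ν / M ^ 2)) ≤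
        volume ({t' : ℝ | ∀ M' : ℝ, (∀ x, ‖u t' x‖ ≤ M') →
            |∫ x, ⟪curl (u t') x, fderiv ℝ (u t') x (curl (u t') x)⟫_ℝ| ≤
              (kStar - ε) * M' * Real.sqrt (∫ x, ‖curl (u t') x‖ ^ 2) *
                Real.sqrt (∫ x, frobeniusNormSq (fderiv ℝ (curl (u t')) x))} ∩
          Set.Icc t (t + τ₁ * ν / M ^ 2))

/-- **W♭ — CLEAN LOCKED WINDOW (flow side, PROVABLE from the landed log-density theorems, the rates and a Vitali selection).** -/
def CleanLockedWindow : Prop :=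
  ∀ (C ν T : ℝ) (u : ℝ → EuclideanSpace ℝ (Fin 3) → EuclideanSpace ℝ (Fin 3)) (p : ℝ → EuclideanSpace ℝ (Fin 3) → ℝ),
    IsViolator C ν T u p →
    ∃ (k : ℝ → ℝ) (Θ G H c_w : ℝ),
      (∀ t ∈ Set.Ico 0 T, ∀ m : ℝ, 0 ≤ m → m < k t → ∃ M : ℝ, (∀ x, ‖u t x‖ ≤ M) ∧
        m * M * Real.sqrt (∫ x, ‖curl (u t) x‖ ^ 2) * Real.sqrt (∫ x, frobeniusNormSq (fderiv ℝ (curl (u t)) x)) <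
          |∫ x, ⟪curl (u t) x, fderiv ℝ (u t) x (curl (u t) x)⟫_ℝ|) ∧
      0 < Θ ∧ 0 < G ∧ 0 < H ∧ 0 < c_w ∧
      ∀ m : ℝ, kStar / 2 ≤ m → m < kStar → ∀ η : ℝ, 0 < η → ∀ τ₁ : ℝ, 0 < τ₁ → τ₁ ≤ c_w →
        ∃ τ M : ℝ, 0 ≤ τ ∧ 0 < M ∧ τ + τ₁ * ν / M ^ 2 < T ∧ (∀ x, ‖u τ x‖ ≤ M) ∧
          (∫ x, ‖curl (u τ) x‖ ^ 2) ≤ Θ * (ν / M) ^ 2 * (∫ x, frobeniusNormSq (fderiv ℝ (curl (u τ)) x)) ∧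
          (∀ x, ‖fderiv ℝ (u τ) x‖ ≤ G * M ^ 2 / ν) ∧
          (∀ t' ∈ Set.Icc τ (τ + τ₁ * ν / M ^ 2), ∀ x, ‖u t' x‖ ≤ H * M) ∧
          volume ({σ : ℝ | k σ ≤ m} ∩ Set.Icc τ (τ + τ₁ * ν / M ^ 2)) ≤ ENNReal.ofReal (η * (τ₁ * ν / M ^ 2))

end Summit.NavierStokesRegularity.NavierStokesRegularity.Theorems.NearExtremalTransiencePerFlow.DepletedFraction

end
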